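import Literature.IUT.LogThetaLattice.LogShellIdentificationBridge
import Literature.IUT.LogThetaLattice.TensorPacketsProofsB
import HarnessLib

/-!
# [IUTchIII] Prop 3.1 (i) — the three FACT-LIST rows F-2122 / F-2123 / F-2124 INSTANTIATED at the
# log-shell model of record (`LogShellBridge`: `𝕜 = ℚ_p`, `log(^α𝓕_v) := K_v` an MLF) and at the
# Rmk 3.1.1 (i) model (`log(^α𝓕_v) := K̄_v`), zero Prop binders

S. Mochizuki, *Inter-universal Teichmüller theory III*, kurims manuscript (May 2020), Prop. 3.1 (i)
"(Ring Structures)", p. 93; Rmk. 3.1.1 (i), pp. 93–94 [cite: Mochizuki2012, III Prop 3.1 (i) p.93].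
Claim key DISPUTED (D-0012); the objects below are classical (finite étale algebras over `ℚ_p`) and this
file takes no side on anything; nothing here bears on [IUTchIII] Cor. 3.12.

PROOF-ONLY companion (no definition, no instance, no notation, no named fact; abc-iut cell, seat
abc-iut-w5-d205 gen 14, abc-iut-L6-lead L6 ROWS #3 row «LF6-22», register `plan/L6/LF-IUT.tsv`).  The
frozen FACT-LIST rows of [IUTchIII] Prop. 3.1 (i) are SCHEMATA over arbitrary families `L α v`
(abc-iut-L6-t4 `TensorPackets.lean`): F-2123 `Prop31i_ringStructures`, F-2124 `Prop31i_ringStructures'`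
(finite level: "`log(^A𝓕_{v_ℚ})` decomposes as a direct sum of [finitely many] fields"; universal closure
REFUTED as typed, abc-iut-L6-t4 `not_forall_prop31i_ringStructures'`) and F-2122
`Prop31i_locallyProductOfFields` (model level: "an inductive limit of direct sums of … fields").  Their
instance forms are PROVED generically by abc-iut-L6-t5 (`Prop31i_ringStructures_of_field_charZero`,
`Prop31i_ringStructures'_of_field`, `Prop31i_locallyProductOfFields_of_isSeparable`, `…_algebraicClosure_of_finite`;
classical input Knus–Merkurjev–Rost–Tignol §18.A, `Literature.RingTheory.Etale`).  THIS FILE evaluates the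
three rows, by application, at the MODEL OF RECORD of the cell — abc-iut-w4-d019's `LogShellBridge`
(`LogShellIdentificationBridge.lean`, p413505): `𝕜 = ℚ_p`, finitely many capsule indices `α ∈ A` and places
`v ∈ Vfib` over `v_ℚ = p`, `log(^α𝓕_v) := K_v` a finite extension of `ℚ_p` (`holField A K`), where only the
instantiation-safe variant `Prop31i_ringStructures''` had been evaluated (`prop31i_ringStructures''_model`) —
and at the Rmk. 3.1.1 (i) model `log(^α𝓕_v) := K̄_v` (an algebraic closure of `K_v`):

* `LogShellBridge.prop31i_ringStructures_model` — F-2123 at `(ℚ_p, holField A K)`;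
* `LogShellBridge.prop31i_ringStructures'_model` — F-2124 at `(ℚ_p, holField A K)`;
* `LogShellBridge.prop31i_locallyProductOfFields_model` — F-2122 at `(ℚ_p, holField A K)`;
* `LogShellBridge.prop31i_locallyProductOfFields_algClosure_model` — F-2122 at the Rmk. 3.1.1 (i) model
  `(ℚ_p, fun α v => AlgebraicClosure (K v))`, the level at which the finite-level schemata F-2123/F-2124 are
  FALSE (abc-iut-L6-t20 RQ7 finding L6-F1; L6-lead ruling D10 (a)) and F-2122 is the dischargeable content.

Residual binders: NONE of Prop kind — only the data of the model (`[Fintype A]`, `[Fintype Vfib]`,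
`[∀ v, FiniteDimensional ℚ_[p] (K v)]`; separability is automatic in characteristic `0`).
HONEST FRAMING: an instance-form theorem at OUR model is not the print universal closure; the rows keep
their FACT-LIST labels; typed ≠ proved elsewhere; nothing here asserts abc proved or refuted.
-/

noncomputable section

namespace Literature.IUT.LogThetaLattice

namespace LogShellBridge

variable (p : ℕ) [hp : Fact p.Prime]
variable {A : Type} {Vfib : Type}
variable (K : Vfib → Type) [∀ v, NontriviallyNormedField (K v)] [∀ v, NormedAlgebra ℚ_[p] (K v)]

/-- **F-2123 `Prop31i_ringStructures` HOLDS at the log-shell model** `(ℚ_p, log(^α𝓕_v) := K_v)`, `K_v/ℚ_p`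
finite, finitely many `α`, `v`: the holomorphic tensor packet `log(^A𝓕_{v_ℚ}) = ⊗_α ⊕_v K_v` is
ring-isomorphic to a finite product of fields ([IUTchIII] Prop. 3.1 (i) p. 93 "direct sum of … fields";
abc-iut-L6-t5 `Prop31i_ringStructures_of_field_charZero`). [claim: Mochizuki2012, status: disputed] -/
theorem prop31i_ringStructures_model [Fintype A] [Fintype Vfib] [∀ v, FiniteDimensional ℚ_[p] (K v)] :
    Prop31i_ringStructures ℚ_[p] (holField A K) :=
  Prop31i_ringStructures_of_field_charZero ℚ_[p] (holField A K)

/-- **F-2124 `Prop31i_ringStructures'` HOLDS at the log-shell model** (same statement body as F-2123;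
abc-iut-L6-t5 `Prop31i_ringStructures'_of_field`, separability automatic over `ℚ_p`).
[claim: Mochizuki2012, status: disputed] -/
theorem prop31i_ringStructures'_model [Fintype A] [Fintype Vfib] [∀ v, FiniteDimensional ℚ_[p] (K v)] :
    Prop31i_ringStructures' ℚ_[p] (holField A K) :=
  have : ∀ (α : A) (v : Vfib), Algebra.IsSeparable ℚ_[p] (holField A K α v) := fun _ _ => inferInstance
  Prop31i_ringStructures'_of_field ℚ_[p] (holField A K)

/-- **F-2122 `Prop31i_locallyProductOfFields` HOLDS at the log-shell model** (finite level ⇒ model level,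
abc-iut-L6-t4 `Prop31i_locallyProductOfFields_of_ringStructures`): every finite subset of `⊗_α ⊕_v K_v` lies
in a `ℚ_p`-subalgebra ring-isomorphic to a finite product of fields. [claim: Mochizuki2012, status: disputed] -/
theorem prop31i_locallyProductOfFields_model [Fintype A] [Fintype Vfib]
    [∀ v, FiniteDimensional ℚ_[p] (K v)] : Prop31i_locallyProductOfFields ℚ_[p] (holField A K) :=
  Prop31i_locallyProductOfFields_of_ringStructures ℚ_[p] (holField A K) (prop31i_ringStructures_model p K)

/-- **F-2122 `Prop31i_locallyProductOfFields` HOLDS at the Rmk. 3.1.1 (i) model** `log(^α𝓕_v) := K̄_v` (an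
algebraic closure of the finite extension `K_v/ℚ_p`; [IUTchIII] Rmk. 3.1.1 (i) pp. 93–94 "`log(^α𝓕_v)` …
`𝒪 ⊆ k̄`"): every finite subset of `⊗_α ⊕_v K̄_v` lies in a `ℚ_p`-subalgebra that is a finite product of
fields — the "inductive limit of direct sums of fields" content of Prop. 3.1 (i), at the level where the
finite-level schemata F-2123/F-2124 are FALSE (abc-iut-L6-t5 `Prop31i_locallyProductOfFields_algebraicClosure_of_finite`).
[claim: Mochizuki2012, status: disputed] -/
theorem prop31i_locallyProductOfFields_algClosure_model [Finite A] [Finite Vfib]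
    [∀ v, FiniteDimensional ℚ_[p] (K v)] :
    Prop31i_locallyProductOfFields ℚ_[p] (fun (_ : A) (v : Vfib) => AlgebraicClosure (K v)) :=
  Prop31i_locallyProductOfFields_algebraicClosure_of_finite ℚ_[p] (fun (_ : A) (v : Vfib) => K v)

end LogShellBridge

end Literature.IUT.LogThetaLattice

end
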